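import Mathlib
import Summits.ResolutionOfSingularities.ResolutionOfSingularities.Theorems.WeightedInvariantLocalWeightedDropWildMonicFlagDropAxisSplit

/-!
# `WeightedInvariant.LocalWeightedDrop`, line `hasse-ridge-face-selection`, S3ρ: the TRANSLATED-POINT DROP (`t ≠ 0`, both letters boundary)
# split by the type of the child flag — three targets of record (Uk-ρD6 ×2, Uk-ρD3)

Crux item stmt-ResolutionOfSingularities-8899 `LocalWeightedDrop` (route `ResolutionOfSingularities/WeightedInvariant`), engine of the door
`HypersurfaceCentreConstruction` stmt-ResolutionOfSingularities-19897.  [OURS · L1 W4.3, chain w43, res-type-083 (S3ρ first seat, (C9) lead).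
MAP: S. Perlega, arXiv:2011.14443 Prop 9.1.4 proof cases (2) («`n_G = 0`, `t ≠ 0` and `E = V(xy)`») and (4) («`n_G > 1` and
`D_G = D_new`») at a translated point, Lemma 9.1.3 (p0105–p0106); every object OURS; not a statement of any manuscript.]

`DropKangarooShape d p k` (`…WildMonicFlagDropSplit`: parent `(A, E)` with BOTH letters boundary, successor `x^{d-j}·T_j = A_j(x, x(t+y))`,
`t ≠ 0`, child `(shift d T φ', succE t E = {0})`, parent maximum `vmax` handed in; every child flag triple `< vmax`) is the conjunction
(`dropKangarooShape_of_cases`) of THREE statements, one per type of the child flag `(o, g, h)` — the child's boundary is `{0}` (`= D_new`;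
both old components are lost), so: first orientation ⇒ `IsN0 {0} h` for EVERY `h` (no tangent flags); second orientation (`swapE {0} = {1}`)
⇒ `h = 0` (curve `= D_new`) or `2 ≤ ord h` (tangent to `D_new`: the KANGAROO):
* `DropKangarooFirst`    — `o = false`, any `h` [case (2); parent flag `(ĝ, t·X + x·h)` has `n_F = 1`; Lemma 9.1.3 for `d_F = −1`] (Uk-ρD6);
* `DropKangarooNewAxis`  — `o = true`, `h = 0`: the flag whose curve is `D_new` [case (2), `G₁ = V(z′+g, x′)`] (Uk-ρD6);
* `DropKangarooTangent`  — `o = true`, `2 ≤ ord h` [case (4) at `t ≠ 0`, parent flag `(ĝ, t·X)` tangent with `n_F = 1`] (Uk-ρD3).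
-/

set_option linter.dupNamespace false -- mandated namespace of this single-conjunct summit

noncomputable section

namespace Summit.ResolutionOfSingularities.ResolutionOfSingularities.Theorems

open Literature.AlgebraicGeometry.Resolution
open Literature.AlgebraicGeometry.Resolution.HauserPerlega2024 (Triple)

namespace WildMonic

open MvPowerSeries
open PurePowerFlag (swap swapE orient orientE IsN0 IsTangent succE)

variable {k : Type} [Field k] {d : ℕ}

/-! ### The common hypothesis block -/

/-- «`(A, E; t, T, φ')` is a charged TRANSLATED STEP WITH TWO LOST COMPONENTS and `vmax` is the parent's maximum»: raw parent position off
`Exit₃` with BOTH letters boundary, its greatest flag triple `vmax` (finite `s`), slope `t ≠ 0`, successor `x^{d-j}·T_j = A_j(x, x(t+y))`,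
re-centring `φ'` to a child position off `Exit₃` (the hypothesis block of `DropKangarooShape`). -/
def IsKangarooStep (d p : ℕ) (A : Fin d → MvPowerSeries (Fin 2) k) (E : Finset (Fin 2)) (t : k) (T : Fin d → MvPowerSeries (Fin 2) k)
    (φ' : MvPowerSeries (Fin 2) k) (vmax : Triple) : Prop :=
  IsPos d A ∧ ¬ Exit₃ p d A ∧ IsFlagTriple d A E vmax ∧ (ofLex (ofLex vmax).2).2 ≠ ⊤ ∧ (∀ u, IsFlagTriple d A E u → u ≤ vmax) ∧
    t ≠ 0 ∧ (0 : Fin 2) ∈ E ∧ (1 : Fin 2) ∈ E ∧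
    (∀ j : Fin d, X 0 ^ (d - (j : ℕ)) * T j = subst (PlaneGerm.dirChart t) (A j)) ∧
    constantCoeff φ' = 0 ∧ IsPos d (shift d T φ') ∧ ¬ Exit₃ p d (shift d T φ')

/-! ### The three child-flag types -/

/-- TYPE FIRST [Per17 9.1.4 case (2)]: first-orientation child flags `(false, g, h)` (all have `n = 0`, the child's boundary being `{D_new}`). -/
def DropKangarooFirst (d p : ℕ) (k : Type) [Field k] : Prop :=
  ∀ (A : Fin d → MvPowerSeries (Fin 2) k) (E : Finset (Fin 2)) (t : k) (T : Fin d → MvPowerSeries (Fin 2) k) (φ' : MvPowerSeries (Fin 2) k)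
    (vmax : Triple), IsKangarooStep d p A E t T φ' vmax →
    ∀ (g : MvPowerSeries (Fin 2) k) (h : PowerSeries k), constantCoeff g = 0 → PowerSeries.constantCoeff h = 0 →
      IsMMax d (shift d T φ') (succE t E) g h →
      flagTriple d (shift d T φ') (succE t E) g h < vmax

/-- TYPE NEW-AXIS [Per17 9.1.4 case (2), `G₁ = G₂ ∩ D_new`]: the second-orientation child flag `(true, g, 0)` whose curve is `D_new`. -/
def DropKangarooNewAxis (d p : ℕ) (k : Type) [Field k] : Prop :=
  ∀ (A : Fin d → MvPowerSeries (Fin 2) k) (E : Finset (Fin 2)) (t : k) (T : Fin d → MvPowerSeries (Fin 2) k) (φ' : MvPowerSeries (Fin 2) k)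
    (vmax : Triple), IsKangarooStep d p A E t T φ' vmax →
    ∀ (g : MvPowerSeries (Fin 2) k), constantCoeff g = 0 →
      IsMMax d (swapT (shift d T φ')) (swapE (succE t E)) g 0 →
      flagTriple d (swapT (shift d T φ')) (swapE (succE t E)) g 0 < vmax

/-- TYPE TANGENT = THE KANGAROO [Per17 9.1.4 case (4) at `t ≠ 0`]: second-orientation child flags `(true, g, h)` with `2 ≤ ord h` (tangent to
`D_new`). -/
def DropKangarooTangent (d p : ℕ) (k : Type) [Field k] : Prop :=
  ∀ (A : Fin d → MvPowerSeries (Fin 2) k) (E : Finset (Fin 2)) (t : k) (T : Fin d → MvPowerSeries (Fin 2) k) (φ' : MvPowerSeries (Fin 2) k)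
    (vmax : Triple), IsKangarooStep d p A E t T φ' vmax →
    ∀ (g : MvPowerSeries (Fin 2) k) (h : PowerSeries k), constantCoeff g = 0 → PowerSeries.constantCoeff h = 0 →
      IsTangent (swapE (succE t E)) h → (2 : ℕ∞) ≤ h.order →
      IsMMax d (swapT (shift d T φ')) (swapE (succE t E)) g h →
      flagTriple d (swapT (shift d T φ')) (swapE (succE t E)) g h < vmax

/-! ### The split -/

/-- At a translated point no old component survives: `succE t E = {0}`. -/
theorem succE_of_ne_zero {t : k} (ht : t ≠ 0) (E : Finset (Fin 2)) : succE t E = {0} := by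
  unfold succE
  rw [if_neg (fun h => ht h.1)]

/-- A second-orientation tangent flag at a translated point has `2 ≤ ord h` (the alternative `ord h = 1` would need the old letter, which is
lost). -/
theorem two_le_order_of_isTangent_swapE_succE {t : k} (ht : t ≠ 0) {E : Finset (Fin 2)} {h : PowerSeries k}
    (hT : IsTangent (swapE (succE t E)) h) : (2 : ℕ∞) ≤ h.order := by
  obtain ⟨-, -, h2 | h0⟩ := hT
  · exact h2
  · exfalso
    rw [PurePowerFlag.mem_swapE, Equiv.swap_apply_left, succE_of_ne_zero ht] at h0
    simp at h0

/-- **`DropKangarooShape` FROM THE THREE CHILD-FLAG TYPES.** -/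
theorem dropKangarooShape_of_cases {p : ℕ} (h1 : DropKangarooFirst d p k) (h2 : DropKangarooNewAxis d p k) (h3 : DropKangarooTangent d p k) :
    DropKangarooShape d p k := by
  intro A E t T φ' vmax hA hex hvmax hs hge ht h0E h1E hT hφ' hpos' hex' w hw
  have hstep : IsKangarooStep d p A E t T φ' vmax := ⟨hA, hex, hvmax, hs, hge, ht, h0E, h1E, hT, hφ', hpos', hex'⟩
  obtain ⟨o, g, h, hg, hh, hadm, hmm, rfl⟩ := hw
  cases o
  · -- first orientation: every flag is an `n = 0` flag
    rw [orientT_false, PurePowerFlag.orientE_false] at hmm ⊢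
    exact h1 A E t T φ' vmax hstep g h hg hh hmm
  · rw [orientT_true, PurePowerFlag.orientE_true] at hmm ⊢
    rw [PurePowerFlag.orientE_true] at hadm
    rcases hadm with hn | htan
    · have h0 : h = 0 := eq_zero_of_isN0_swapE_succE hn
      subst h0
      exact h2 A E t T φ' vmax hstep g hg hmm
    · exact h3 A E t T φ' vmax hstep g h hg hh htan (two_le_order_of_isTangent_swapE_succE ht htan) hmm

end WildMonic

end Summit.ResolutionOfSingularities.ResolutionOfSingularities.Theorems

end
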